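import Mathlib
import HarnessLib
import Literature.Analysis.FluidPDE.Tao2016AveragedNS.LocalCascadeSolutions
import Literature.Analysis.FluidPDE.Tao2016AveragedNS.RenormalisedCascadeWaves
import Summits.NavierStokesRegularity.NavierStokesRegularity.Theorems.TaoLadderRungTwoBreakEternalRigidityViscBddOneDefs
import Summits.NavierStokesRegularity.NavierStokesRegularity.Theorems.TaoLadderRungTwoBreakEternalRigidityViscBddOneCriticalRate
import Summits.NavierStokesRegularity.NavierStokesRegularity.Theorems.TaoLadderRungTwoBreakBlowupRigidityOneRenormalisedFlow
import Summits.NavierStokesRegularity.NavierStokesRegularity.Theorems.WakeRatchetMinimalViscousBlowupClosedValve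
import Summits.NavierStokesRegularity.NavierStokesRegularity.Theorems.WakeRatchetMinimalViscousBlowupThresholdContinuity

/-!
# Crux `TaoLadderRungTwoBreak.EternalRigidityViscBddOne` (stmt-NavierStokesRegularity-20420): the RENORMALISED viscous blow-up trajectory is
# NON-DEGENERATE in sup-norm at every log-time — `sup_n ‖W_n(σ)‖ ≥ 1/(32(3+Λ))` (log-time form of the minimal blow-up rate, in the
# renormalisation convention `W_n(σ) = Λ^n e^{−σ} X_n(t⋆ − e^{−σ})` of `BlowupRigidityOne.RenormalisedFlow` / `…RenormalisedViscousFlow`)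

MODEL lattice ODEs only (Tao 2016 §4, §6.4: self-similar variables of the exact NS-scaled `ν`-viscous cascade lattice, table of `InTableClass R`,
`m = 4`, registered vocabulary `ViscousUpTo` / `BlowsUpAt` / `TypeOne` of the skeleton `85fbfe8e90eea58b`); nothing here is a statement about the
Navier–Stokes equations; no stub, crux or summit is closed (`--supports stmt-NavierStokesRegularity-20420`).

* `renormalised_norm_lower_bound` — `ViscousUpTo ε₀ ν α X₀ X t⋆ ∧ BlowsUpAt ε₀ X t⋆`, `W_n(σ) = Λ^n e^{−σ} X_n(t⋆ − e^{−σ})` ⟹ at every log-time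
  `σ` with `e^{−σ} ≤ t⋆` some shell `n ≥ 0` has `‖W_n(σ)‖ ≥ 1/(32(3+Λ))` (`CriticalRate.typeOne_quantity_lower_bound` read through
  `renormalisedFlow_norm`);
* `renormalised_shell_of_typeOne` — with `TypeOne` (constant `C`, `uniformBound_iff_typeI`): at every such `σ` some shell has
  `1/(32(3+Λ)) ≤ ‖W_n(σ)‖ ≤ 2C` — the trajectory that (ω4) `stub_eternalLimitViscBdd` renormalises (`renormalisedViscousFlow_law`) lives in a
  fixed sup-norm shell, so every locally uniform ω-limit of its recentrings at the maximising shells is a NON-ZERO bounded solution of the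
  eternal law (admissibility and (S₁)-survival are the open part).
HONEST LABEL: corollary packaging; (ω3), (ω4), ⟨20420⟩ and every NS statement remain OPEN; rung 0.
-/

noncomputable section

-- the summit and its single sub-problem share the name (CONVENTIONS §1)
set_option linter.dupNamespace false

open Set Filter Topology
open Literature.Analysis.FluidPDE Literature.Analysis.FluidPDE.TaoCascade
open Summit.NavierStokesRegularity.NavierStokesRegularity.Theorems.MinimalViscousBlowup.ThresholdRay
open Summit.NavierStokesRegularity.NavierStokesRegularity.Theorems.BlowupRigidityOne
open Summit.NavierStokesRegularity.NavierStokesRegularity.Theorems.EternalRigidityViscBddOne.Birth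
open Summit.NavierStokesRegularity.NavierStokesRegularity.Theorems.EternalRigidityViscBddOne.CriticalRate

namespace Summit.NavierStokesRegularity.NavierStokesRegularity.Theorems.EternalRigidityViscBddOne.CriticalFront

/-- **THE RENORMALISED VISCOUS BLOW-UP TRAJECTORY NEVER ENTERS THE SUP-BALL OF RADIUS `1/(32(3+Λ))`.**  For a table of `InTableClass R`,
`ε₀ > 0`, `ν > 0`, a viscous blow-up `ViscousUpTo ε₀ ν α X₀ X t⋆ ∧ BlowsUpAt ε₀ X t⋆` and its renormalisation
`W_n(σ) = Λ^n e^{−σ} X_n(t⋆ − e^{−σ})`: at every log-time `σ` with `e^{−σ} ≤ t⋆` some shell `n ≥ 0` has `‖W_n(σ)‖ ≥ 1/(32(3+Λ))`.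
[cite: Tao2016AveragedNS, §4 (4.1), §6.4 (self-similar variables); Teschl2012, §2.6; cell vocabulary (stmt-NavierStokesRegularity-20420)] -/
theorem renormalised_norm_lower_bound {R ε₀ ν : ℝ} (hε₀ : 0 < ε₀) (hν : 0 < ν)
    {α : Fin 4 → Fin 4 → Fin 4 → ℤ × ℤ × ℤ → ℝ} (hα : InTableClass R α) {X₀ : Fin 4 → ℝ}
    {X : Fin 4 → ℤ → ℝ → ℝ} {tStar : ℝ} (hV : ViscousUpTo ε₀ ν α X₀ X tStar) (hB : BlowsUpAt ε₀ X tStar)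
    {W : ℤ → ℝ → Em 4} (hW : ∀ n σ, W n σ = (bigLam ε₀ ^ n * Real.exp (-σ)) • shellVec X n (tStar - Real.exp (-σ))) :
    ∀ σ : ℝ, Real.exp (-σ) ≤ tStar → ∃ n : ℤ, 0 ≤ n ∧ 1 / (32 * (3 + bigLam ε₀)) ≤ ‖W n σ‖ := by
  intro σ hσ
  have hΛ : 0 < bigLam ε₀ := bigLam_pos (by linarith)
  have hexp : 0 < Real.exp (-σ) := Real.exp_pos _
  set t : ℝ := tStar - Real.exp (-σ) with htdef
  have ht0 : 0 ≤ t := by rw [htdef]; linarith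
  have htT : t < tStar := by rw [htdef]; linarith
  have hTt : tStar - t = Real.exp (-σ) := by rw [htdef]; ring
  obtain ⟨i, F, hF⟩ := typeOne_quantity_lower_bound hε₀ hν hα hV hB t ht0 htT
  have hF0 : 0 ≤ F := by
    by_contra hneg
    push Not at hneg
    rw [hV.noLow i F t hneg ht0 htT, abs_zero, mul_zero, zero_mul] at hF
    have : (0 : ℝ) < 1 / (32 * (3 + bigLam ε₀)) := by positivity
    linarith
  refine ⟨F, hF0, hF.trans ?_⟩
  rw [renormalisedFlow_norm hε₀ hW F σ, ← htdef, hTt]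
  have h1 := abs_apply_le_norm_shellVec X F t i
  have h2 : 0 ≤ bigLam ε₀ ^ F * Real.exp (-σ) := (mul_pos (zpow_pos hΛ F) hexp).le
  calc bigLam ε₀ ^ F * |X i F t| * Real.exp (-σ) = bigLam ε₀ ^ F * Real.exp (-σ) * |X i F t| := by ring
    _ ≤ bigLam ε₀ ^ F * Real.exp (-σ) * ‖shellVec X F t‖ := mul_le_mul_of_nonneg_left h1 h2

/-- **Under TYPE I the renormalised trajectory lives in a fixed sup-norm shell.**  With `TypeOne ε₀ X t⋆` (constant read through
`uniformBound_iff_typeI`'s direction «type I ⟹ bound»: `‖W_n(σ)‖ ≤ Λ^n e^{−σ}‖X_n‖ ≤ 2C`), at every log-time `σ` with `e^{−σ} ≤ t⋆` there is a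
shell `n ≥ 0` with `1/(32(3+Λ)) ≤ ‖W_n(σ)‖` and ALL shells obey `‖W_k(σ)‖ ≤ 2C`.  MODEL lattice only.
[cite: Tao2016AveragedNS, §4 (4.1), §6.4; Teschl2012, §2.6; cell vocabulary (stmt-NavierStokesRegularity-20420, `TypeOne`)] -/
theorem renormalised_shell_of_typeOne {R ε₀ ν : ℝ} (hε₀ : 0 < ε₀) (hν : 0 < ν)
    {α : Fin 4 → Fin 4 → Fin 4 → ℤ × ℤ × ℤ → ℝ} (hα : InTableClass R α) {X₀ : Fin 4 → ℝ}
    {X : Fin 4 → ℤ → ℝ → ℝ} {tStar : ℝ} (hV : ViscousUpTo ε₀ ν α X₀ X tStar) (hB : BlowsUpAt ε₀ X tStar)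
    (hT1 : TypeOne ε₀ X tStar)
    {W : ℤ → ℝ → Em 4} (hW : ∀ n σ, W n σ = (bigLam ε₀ ^ n * Real.exp (-σ)) • shellVec X n (tStar - Real.exp (-σ))) :
    ∃ C : ℝ, ∀ σ : ℝ, Real.exp (-σ) ≤ tStar →
      (∃ n : ℤ, 0 ≤ n ∧ 1 / (32 * (3 + bigLam ε₀)) ≤ ‖W n σ‖) ∧ ∀ k : ℤ, ‖W k σ‖ ≤ C := by
  obtain ⟨C₀, hC₀⟩ := hT1
  have hΛ : 0 < bigLam ε₀ := bigLam_pos (by linarith)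
  refine ⟨2 * max C₀ 0, fun σ hσ => ⟨renormalised_norm_lower_bound hε₀ hν hα hV hB hW σ hσ, fun k => ?_⟩⟩
  have hexp : 0 < Real.exp (-σ) := Real.exp_pos _
  set t : ℝ := tStar - Real.exp (-σ) with htdef
  have ht0 : 0 ≤ t := by rw [htdef]; linarith
  have htT : t < tStar := by rw [htdef]; linarith
  have hTt : tStar - t = Real.exp (-σ) := by rw [htdef]; ring
  have hLk : 0 < bigLam ε₀ ^ k * Real.exp (-σ) := mul_pos (zpow_pos hΛ k) hexp
  -- every component obeys `Λ^k e^{-σ} |X_{j,k}(t)| ≤ C₀ ≤ max C₀ 0`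
  have hcomp : ∀ j : Fin 4, |X j k t| ≤ max C₀ 0 / (bigLam ε₀ ^ k * Real.exp (-σ)) := by
    intro j
    rw [le_div_iff₀ hLk]
    have h := hC₀ t ht0 htT j k
    rw [hTt] at h
    calc |X j k t| * (bigLam ε₀ ^ k * Real.exp (-σ)) = bigLam ε₀ ^ k * |X j k t| * Real.exp (-σ) := by ring
      _ ≤ C₀ := h
      _ ≤ max C₀ 0 := le_max_left _ _
  have hnorm := norm_shellVec_le_two_mul (div_nonneg (le_max_right _ _) hLk.le) hcomp
  rw [renormalisedFlow_norm hε₀ hW k σ, ← htdef]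
  calc bigLam ε₀ ^ k * Real.exp (-σ) * ‖shellVec X k t‖
      ≤ bigLam ε₀ ^ k * Real.exp (-σ) * (2 * (max C₀ 0 / (bigLam ε₀ ^ k * Real.exp (-σ)))) :=
        mul_le_mul_of_nonneg_left hnorm hLk.le
    _ = 2 * max C₀ 0 := by field_simp

end Summit.NavierStokesRegularity.NavierStokesRegularity.Theorems.EternalRigidityViscBddOne.CriticalFront

end
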